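import Summits.NavierStokesRegularity.NavierStokesRegularity.Theorems.QuantisedSymmetryPolyhedralDssProfileExistsStubSchurJet
import Literature.Analysis.FluidPDE.PressurePoisson
import Literature.Analysis.FluidPDE.IsometryInvariance
import Literature.Analysis.FluidPDE.ClassicalSolution
import HarnessLib

/-!
# Crux `PolyhedralDssProfileExists` (stmt-NavierStokesRegularity-1404), line `polyhedral_cell` —
# stub `stub_centreJet2` (the second-order jet at the symmetry centre)

Let `G` be a group of linear isometries of `ℝ³ = EuclideanSpace ℝ (Fin 3)` acting irreducibly
(every `G`-invariant subspace is `⊥` or `⊤`), and let `(V, p)` be a classical solution of the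
Navier–Stokes equations (`ν = 1`, no force) on the open past `Iio 0`
(`IsClassicalNSSolutionOn (Iio 0) 1 0 V p`) whose velocity is `G`-equivariant slice by slice,
`V t (g x) = g (V t x)`. Then at every `t < 0` the jet of the solution at the centre `x = 0` is
trivial to second order:

* `V(t, 0) = 0`, `DV(t, 0) = 0` — the Schur jet of the equivariant slice `V t` (the landed stub
  `stub_schurJet`: a `G`-fixed vector vanishes, and an intertwiner of `G` of trace
  `tr DV = div V = 0` vanishes; Serre, *Linear Representations of Finite Groups*, §13.2);
* `ΔV(t, 0) = 0` — the Laplacian is covariant under linear isometries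
  (`laplacian_conj_linearIsometryEquiv`), so `ΔV(t, ·)` is again `G`-equivariant and its value at
  the centre is a `G`-fixed vector;
* `∇p(t, 0) = 0`, `D∇p(t, 0) = 0` — the conjugated pair `(g V g⁻¹, p ∘ g⁻¹) = (V, p ∘ g⁻¹)` is a
  classical solution with the *same* velocity (`IsClassicalNSSolutionOn.conj_linearIsometryEquiv`,
  Majda–Bertozzi, §1.2, Prop. 1.1 (iii)), so the two momentum equations give
  `∇p(t) = ∇(p(t) ∘ g⁻¹) = g ∘ ∇p(t) ∘ g⁻¹`: the pressure gradient is `G`-equivariant. Its Schur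
  jet vanishes because it is trace free at the centre:
  `tr D∇p(t, 0) = div ∇p(t, 0) = Δp(t, 0) = -div((V·∇)V)(t, 0)` (pressure Poisson equation,
  Tao 2011, (8)) and `D((V·∇)V)(0) = DV(0) ∘ DV(0) + D²V(0)(·, V(0)) = 0`.
-/

noncomputable section

open MeasureTheory Set Function Filter Topology
open Literature.Analysis.FluidPDE
open scoped InnerProductSpace RealInnerProductSpace Laplacian

-- the summit namespace `…NavierStokesRegularity.NavierStokesRegularity…` is the tree convention (D-0017)
set_option linter.dupNamespace false

namespace Summit.NavierStokesRegularity.NavierStokesRegularity.Theorems.PolyhedralDssProfileExists.PolyhedralCell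

/-- **Equivariant fields are conjugation invariant**: if `w (g x) = g (w x)` for all `x`, then
`g ∘ w ∘ g⁻¹ = w`. [folklore] -/
theorem centreJet2_conj_eq {g : EuclideanSpace ℝ (Fin 3) ≃ₗᵢ[ℝ] EuclideanSpace ℝ (Fin 3)}
    {w : EuclideanSpace ℝ (Fin 3) → EuclideanSpace ℝ (Fin 3)} (hw : ∀ x, w (g x) = g (w x)) :
    (fun y => g (w (g.symm y))) = w := by
  funext y
  rw [← hw (g.symm y), LinearIsometryEquiv.apply_symm_apply]

/-- **The Laplacian of an equivariant field is equivariant**: `Δw (g x) = g (Δw x)` for a linear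
isometry `g` with `w ∘ g = g ∘ w` (covariance of `Δ` under isometries applied to
`w = g ∘ w ∘ g⁻¹`; Majda–Bertozzi, §1.2, Prop. 1.1 (iii)). [folklore] -/
theorem centreJet2_laplacian_equivariant
    {g : EuclideanSpace ℝ (Fin 3) ≃ₗᵢ[ℝ] EuclideanSpace ℝ (Fin 3)}
    {w : EuclideanSpace ℝ (Fin 3) → EuclideanSpace ℝ (Fin 3)} (hw : ∀ x, w (g x) = g (w x))
    (x : EuclideanSpace ℝ (Fin 3)) : (Δ w) (g x) = g ((Δ w) x) := by
  have h1 := laplacian_conj_linearIsometryEquiv g w (g x)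
  rw [centreJet2_conj_eq hw, LinearIsometryEquiv.symm_apply_apply] at h1
  exact h1

/-- **The pressure gradient of an equivariant solution is equivariant.** If `(V, p)` is a
classical solution on the open past whose velocity commutes with the linear isometry `g`, then
the conjugated pair `(g V g⁻¹, p ∘ g⁻¹) = (V, p ∘ g⁻¹)` is again a classical solution (rotation
covariance, Majda–Bertozzi, §1.2, Prop. 1.1 (iii)); comparing the two momentum equations, which
share the velocity, `∇p(t) (g x) = ∇(p(t) ∘ g⁻¹) (g x) = g (∇p(t) x)`. [folklore] -/
theorem centreJet2_gradient_equivariant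
    {V : ℝ → EuclideanSpace ℝ (Fin 3) → EuclideanSpace ℝ (Fin 3)}
    {p : ℝ → EuclideanSpace ℝ (Fin 3) → ℝ} (h : IsClassicalNSSolutionOn (Iio 0) 1 0 V p)
    {g : EuclideanSpace ℝ (Fin 3) ≃ₗᵢ[ℝ] EuclideanSpace ℝ (Fin 3)}
    (hg : ∀ t x, V t (g x) = g (V t x)) {t : ℝ} (ht : t < 0) (x : EuclideanSpace ℝ (Fin 3)) :
    gradient (p t) (g x) = g (gradient (p t) x) := by
  have ht' : t ∈ Iio (0 : ℝ) := ht
  have hconj : (fun s y => g (V s (g.symm y))) = V := funext fun s => centreJet2_conj_eq (hg s)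
  have h' := h.conj_linearIsometryEquiv g isOpen_Iio.uniqueDiffOn
  rw [hconj] at h'
  have hm := h'.momentum t ht' (g x)
  rw [h.momentum t ht' (g x), gradient_comp_linearIsometryEquiv_symm g,
    LinearIsometryEquiv.symm_apply_apply] at hm
  simpa using hm

/-- **The convective term is flat at a degenerate stagnation point**: if `w` is `C²` with
`w 0 = 0` and `Dw(0) = 0`, then `D((w·∇)w)(0) = Dw(0) ∘ Dw(0) + D²w(0)(·, w 0) = 0`
(Leibniz rule for `y ↦ Dw(y) (w y)`). [folklore] -/
theorem centreJet2_fderiv_convect_eq_zero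
    {w : EuclideanSpace ℝ (Fin 3) → EuclideanSpace ℝ (Fin 3)} (hw : ContDiff ℝ 2 w)
    (h0 : w 0 = 0) (hD : fderiv ℝ w 0 = 0) : fderiv ℝ (convect w w) 0 = 0 := by
  have hwd : Differentiable ℝ w := hw.differentiable two_ne_zero
  have hDd : Differentiable ℝ (fderiv ℝ w) :=
    (hw.fderiv_right (m := 1) le_rfl).differentiable one_ne_zero
  have hc : convect w w = fun y => fderiv ℝ w y (w y) := rfl
  rw [hc, fderiv_clm_apply (hDd 0) (hwd 0), h0, hD]
  simp

/-- **Stub N8: the second-order jet at the centre.** Let `G` act irreducibly on `ℝ³` by linear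
isometries and let `(V, p)` be a classical Navier–Stokes solution (`ν = 1`, `f = 0`) on the open
past `Iio 0` with `G`-equivariant velocity slices. Then for every `t < 0`:
`V(t, 0) = 0` and `DV(t, 0) = 0` (the Schur jet of `V t`, `stub_schurJet`, with
`tr DV = div V = 0`); `ΔV(t, 0) = 0` (`ΔV(t, ·)` is `G`-equivariant, so its value at the centre is
`G`-fixed); `∇p(t, 0) = 0` and `D∇p(t, 0) = 0`: the pressure gradient is `G`-equivariant (the
conjugated pair `(V, p ∘ g⁻¹)` solves the same momentum equation), and its derivative at the
centre is a trace-free intertwiner, since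
`tr D∇p(t, 0) = Δp(t, 0) = -div((V·∇)V)(t, 0) = -tr (DV(0)² + D²V(0)(·, V(0))) = 0` by the
pressure Poisson equation. For the crux this says that the blow-up centre of a polyhedrally
symmetric profile is a stagnation point flat to second order in velocity and pressure gradient.
[cite: SerreLinearRepresentations1977, §13.2 (real Schur lemma)] [cite: Tao2011, (8)] -/
theorem stub_centreJet2 :
    ∀ (G : Subgroup (EuclideanSpace ℝ (Fin 3) ≃ₗᵢ[ℝ] EuclideanSpace ℝ (Fin 3))),
      (∀ W : Submodule ℝ (EuclideanSpace ℝ (Fin 3)), (∀ g ∈ G, ∀ v ∈ W, g v ∈ W) → W = ⊥ ∨ W = ⊤) →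
      ∀ (V : ℝ → EuclideanSpace ℝ (Fin 3) → EuclideanSpace ℝ (Fin 3)) (p : ℝ → EuclideanSpace ℝ (Fin 3) → ℝ),
        IsClassicalNSSolutionOn (Set.Iio 0) 1 0 V p → (∀ g ∈ G, ∀ t x, V t (g x) = g (V t x)) →
        ∀ t < 0, V t 0 = 0 ∧ fderiv ℝ (V t) 0 = 0 ∧ (Δ (V t)) 0 = 0 ∧
          gradient (p t) 0 = 0 ∧ fderiv ℝ (gradient (p t)) 0 = 0 := by
  intro G hirr V p h hequ t ht
  have ht' : t ∈ Iio (0 : ℝ) := ht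
  -- the Schur jet of the equivariant slice `V t`
  have hVeq : ∀ g ∈ G, ∀ x, V t (g x) = g (V t x) := fun g hg x => hequ g hg t x
  obtain ⟨hV0, hDV⟩ := stub_schurJet G hirr (V t) hVeq
  have hV2 : ContDiff ℝ 2 (V t) := contDiff_infty.1 (h.contDiff_velocity ht') 2
  have hDV0 : fderiv ℝ (V t) 0 = 0 := hDV (hV2.differentiable two_ne_zero 0) (h.divFree t ht' 0)
  -- the Laplacian of the slice is equivariant, hence `G`-fixed at the centre
  have hLap : ∀ g ∈ G, ∀ x, (Δ (V t)) (g x) = g ((Δ (V t)) x) := fun g hg x =>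
    centreJet2_laplacian_equivariant (hVeq g hg) x
  have hLap0 : (Δ (V t)) 0 = 0 := (stub_schurJet G hirr _ hLap).1
  -- the pressure gradient is equivariant; its Schur jet
  have hgrad : ∀ g ∈ G, ∀ x, gradient (p t) (g x) = g (gradient (p t) x) := fun g hg x =>
    centreJet2_gradient_equivariant h (hequ g hg) ht x
  obtain ⟨hgrad0, hDgrad⟩ := stub_schurJet G hirr _ hgrad
  -- regularity of the pressure gradient, and its divergence at the centre (pressure Poisson)
  have hp2 : ContDiff ℝ 2 (p t) := contDiff_infty.1 (h.contDiff_pressure ht') 2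
  have hgd : DifferentiableAt ℝ (gradient (p t)) 0 := by
    have hg1 : ContDiff ℝ 1 (gradient (p t)) :=
      (InnerProductSpace.toDual ℝ (EuclideanSpace ℝ (Fin 3))).symm.contDiff.comp
        (hp2.fderiv_right (m := 1) le_rfl)
    exact hg1.differentiable one_ne_zero 0
  have htint : t ∈ interior (Iio (0 : ℝ)) := by
    rw [isOpen_Iio.interior_eq]
    exact ht'
  have hdiv : VectorCalculus.divergence (gradient (p t)) 0 = 0 := by
    rw [divergence_gradient hp2, laplacian_pressure_eq_of_isClassicalNSSolutionOn h htint 0]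
    simp [VectorCalculus.divergence, centreJet2_fderiv_convect_eq_zero hV2 hV0 hDV0]
  exact ⟨hV0, hDV0, hLap0, hgrad0, hDgrad hgd hdiv⟩

end Summit.NavierStokesRegularity.NavierStokesRegularity.Theorems.PolyhedralDssProfileExists.PolyhedralCell
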